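import Summits.ABC.IUTFork.Conditional.HexHullThresholdGenuine
import Summits.ABC.IUTFork.Repair.CandInternal2RealGapRows
import HarnessLib

/-!
# Branch C / R-H × R-W «GENUINE-NEG» ROWS through R-H row 4's floor-exact hull threshold: the HEX datum `λ_k = 1/2 + 2/7^k` is decided on
# the refuted side for `k ∈ {8, 9, 10, 11}` at EVERY prime `11 ≤ l ≤ 71` with `l ∤ k`

PROOF-ONLY file (0 definitions, 0 `Prop` facts, no instance, no notation) of the abc-iut cell (seat abc-iut-rh-typ-4 gen 2; D-0079 rescue
sub-cells R-H / R-W, lane U). TAKES NO SIDE on [IUTchIII] Cor. 3.12 (S. Mochizuki, *Inter-universal Teichmüller theory III*, RIMS manuscript,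
Cor. 3.12 p. 173–174, Step (xi-f) p. 184) or on any author.

INPUT (one application per row, nothing restated): this seat's ENGINE `GenuineK.not_pilotKummerCompatHull_lamSeven_of_not_hullCell`
(`Conditional/HexHullThresholdGenuine`, p473071) with the local type `B = 15` for even `k` (abc-iut-w4-d087's `GenuineK.localType_lamSeven_fifteen`)
and `B = 30` for odd `k` (abc-iut-W-neg-1's `GenuineK.localType_lamSeven_thirty`), at the TOP label `i + 1 = l⋇ = (l−1)/2`.
* §1 `HexHullThreshold.eq_of_dvd_fifteen` — the divisors of `15` (those of `30`: abc-iut's `CandInternal2RealGapRows.eq_of_dvd_thirty`).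
* §2 THE CELL TABLES (`norm_num` per cell, R-H row 4's column `Repair.RH.HullThresholdExact.HullCell` at `(e, m_q, j, r_in, r_out) =
  (l·d, k·d, l⋇, ⌊l·d/6⌋+1, 7^{a₀} − a₀·l·d)`): `HexHullThreshold.cells_even` — `k ∈ {8, 10}`, `d ∣ 15`, all 16 primes `11 ≤ l ≤ 71`;
  `HexHullThreshold.cells_odd` — `k ∈ {9, 11}`, `d ∣ 30`, the same primes, `l ∤ k`. Every cell FAILS (the values agree cell-for-cell with
  rw-num-lead's `verdict_U2cell` / `margin_U2cell` columns of `plan/rescue/R-W/WINDOW-TABLE.tsv` where the row exists, e.g. `(8, 11, e_v = 15)`: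
  `165·⌊2012/165⌋ = 1980 > 1806`, margin `−174`).
* §3 **`HexHullThreshold.not_pilotKummerCompatHull_lamSeven_even`** (`k ∈ {8, 10}`) and **`…_odd`** (`k ∈ {9, 11}`, `l ∤ k`): at EVERY genuine
  Θ-volume datum `T` over `(ratPoint λ_k, l)`, `l ∈ {11, 13, …, 71}` prime, for EVERY choice of the free context binders and Kummer data, the
  hull-level clause `Cor312Vol.PilotKummerCompatHull` at the sharp genuine setting with the CHOSEN realising ideles and the PINNED reading FAILS.
KERNEL HEX FRONTIER after this file (refuted side, genuine `K`-line, chosen ideles): combined with abc-iut-W-neg-2's p462253 / p462041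
(`13 @ l ≤ 3361`, `12 @ 11–480`, `11 @ 17–480`, `10 @ 23–67`, `9 @ {53,59,61,67}`): **every `k ≥ 8` at every prime `11 ≤ l ≤ 67` with
`l ∤ k`**, plus `k ∈ {8,…,11} @ l = 71`; NEW classes: `8 @ 11–71`, `9 @ 11–47 ∪ {71}`, `10 @ {11,13,17,19,71}`, `(11, 13)` (the row no bound
`≥ 30·l` with the [LIN] engine decides), `(11, 71)`. Below `k = 8` the column does NOT fail at every admissible `d` (e.g. `(7, 19)`: `e_v = 30`
cell inhabited) — WINDOW for this engine, in agreement with the R-W table.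
HONEST SCOPE: SHARP reading; the per-label licence is a STRONGER-THAN-PRINT sufficient form of (xi-f); a failing top-label diagonal packet says
NOTHING about the printed GLOBAL inequality, the number-level `Cor22.Cor312AtDatum`, or any author's intended hull; HEX rows are Szpiro-GOOD
(they test the WINDOW binder `hSHw` of the uncut records only); admissibility `CondP6` of `(λ_k, l)` is NOT asserted (the theorems hold at every
datum `T`); no side taken on any author; typed ≠ proved; refuted-as-typed ≠ refuted-in-print; no abc claim.
[cite: Mochizuki2012, IUTchIII Cor. 3.12 Step (xi-f) p. 184; IUTchIV Prop. 1.1 p. 9, Prop. 1.2 (i)(ii) p. 10] [cite: DupuyHilado2025, §3.4, §4.9, §4.12]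
[claim: Mochizuki2012, status: disputed] for every IUT quotation.
-/

noncomputable section

open Set Function NumberField IsDedekindDomain

namespace Summit.ABC.IUTFork.Conditional

open Thm311 Thm311.Real Cor312 Cor312Vol Cor312Prov Literature.IUT.LogThetaLattice Literature.IUT.LogVolume
  Literature.IUT.HodgeTheaters Literature.IUT.LogVolume.ThetaData
  Literature.NumberTheory.NumberFields Literature.NumberTheory.DiophantineGeometry.GenEll
  Literature.NumberTheory.DiophantineGeometry Summit.ABC.ABC.Theorems Literature.NumberTheory.GaloisRepresentations.Ultrametric
  Summit.ABC.IUTFork.Repair.RH.HullThresholdExact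

/-! ## §1. Divisor lists -/

/-- The divisors of `15`. [folklore] -/
theorem HexHullThreshold.eq_of_dvd_fifteen {d : ℕ} (hd : d ∣ 15) : d = 1 ∨ d = 3 ∨ d = 5 ∨ d = 15 := by
  have h := Nat.le_of_dvd (by norm_num) hd
  interval_cases d <;> first | (norm_num at hd; done) | simp

/-! ## §2. The cell tables (R-H row 4's column at the top label, every admissible local type) -/

/-- **CELL TABLE, even `k ∈ {8, 10}` (`B = 15`)**: for every prime `11 ≤ l ≤ 71` and every `d ∣ 15`, the column `HullCell` FAILS at
`(l·d, k·d, l⋇, ⌊l·d/6⌋+1, 7^{a₀} − a₀·l·d)`, `a₀` the turning point (`7^a·6 < l·d ≤ 7^{a₀}·6` for `a < a₀`). Per cell by `norm_num`. [folklore] -/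
theorem HexHullThreshold.cells_even : ∀ k ∈ ({8, 10} : Finset ℕ), ∀ l ∈ ({11, 13, 17, 19, 23, 29, 31, 37, 41, 43, 47, 53, 59, 61, 67, 71} : Finset ℕ),
    ∀ d : ℕ, d ∣ 15 → ∃ a₀ : ℕ, (∀ a, a < a₀ → (1 : ℤ) * (7 : ℤ) ^ a * ((7 : ℤ) - 1) < ((l * d : ℕ) : ℤ)) ∧
      ((l * d : ℕ) : ℤ) ≤ 1 * (7 : ℤ) ^ a₀ * ((7 : ℤ) - 1) ∧
      ¬ HullCell ((l * d : ℕ) : ℤ) ((k * d : ℕ) : ℤ) ((((l - 1) / 2 - 1 : ℕ) : ℤ) + 1) ((l * d / 6 + 1 : ℕ) : ℤ)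
        ((7 : ℤ) ^ a₀ - (a₀ : ℤ) * ((l * d : ℕ) : ℤ)) := by
  intro k hk l hl d hd
  simp only [Finset.mem_insert, Finset.mem_singleton] at hk hl
  rcases hk with rfl | rfl <;> rcases hl with rfl | rfl | rfl | rfl | rfl | rfl | rfl | rfl | rfl | rfl | rfl | rfl | rfl | rfl | rfl | rfl
  all_goals
    rcases HexHullThreshold.eq_of_dvd_fifteen hd with rfl | rfl | rfl | rfl
    all_goals
      first
      | (refine ⟨1, ?_, ?_, ?_⟩ <;>
          [(intro a ha; interval_cases a; (norm_num; done)); (norm_num; done); (norm_num [HullCell]; done)])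
      | (refine ⟨2, ?_, ?_, ?_⟩ <;>
          [(intro a ha; interval_cases a <;> (norm_num; done)); (norm_num; done); (norm_num [HullCell]; done)])
      | (refine ⟨3, ?_, ?_, ?_⟩ <;>
          [(intro a ha; interval_cases a <;> (norm_num; done)); (norm_num; done); (norm_num [HullCell]; done)])
/-- **CELL TABLE, odd `k ∈ {9, 11}` (`B = 30`)**: for every prime `11 ≤ l ≤ 71` with `l ∤ k` and every `d ∣ 30`, the column FAILS at the
same integers. Per cell by `norm_num`. [folklore] -/
theorem HexHullThreshold.cells_odd : ∀ k ∈ ({9, 11} : Finset ℕ), ∀ l ∈ ({11, 13, 17, 19, 23, 29, 31, 37, 41, 43, 47, 53, 59, 61, 67, 71} : Finset ℕ), ¬ l ∣ k →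
    ∀ d : ℕ, d ∣ 30 → ∃ a₀ : ℕ, (∀ a, a < a₀ → (1 : ℤ) * (7 : ℤ) ^ a * ((7 : ℤ) - 1) < ((l * d : ℕ) : ℤ)) ∧
      ((l * d : ℕ) : ℤ) ≤ 1 * (7 : ℤ) ^ a₀ * ((7 : ℤ) - 1) ∧
      ¬ HullCell ((l * d : ℕ) : ℤ) ((k * d : ℕ) : ℤ) ((((l - 1) / 2 - 1 : ℕ) : ℤ) + 1) ((l * d / 6 + 1 : ℕ) : ℤ)
        ((7 : ℤ) ^ a₀ - (a₀ : ℤ) * ((l * d : ℕ) : ℤ)) := by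
  intro k hk l hl hlk d hd
  simp only [Finset.mem_insert, Finset.mem_singleton] at hk hl
  rcases hk with rfl | rfl <;> rcases hl with rfl | rfl | rfl | rfl | rfl | rfl | rfl | rfl | rfl | rfl | rfl | rfl | rfl | rfl | rfl | rfl
  all_goals
    first
    | exact absurd dvd_rfl hlk
    | (rcases Summit.ABC.IUTFork.Repair.CandInternal2RealGapRows.eq_of_dvd_thirty hd with rfl | rfl | rfl | rfl | rfl | rfl | rfl | rfl
       all_goals
         first
         | (refine ⟨1, ?_, ?_, ?_⟩ <;>
             [(intro a ha; interval_cases a; (norm_num; done)); (norm_num; done); (norm_num [HullCell]; done)])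
         | (refine ⟨2, ?_, ?_, ?_⟩ <;>
             [(intro a ha; interval_cases a <;> (norm_num; done)); (norm_num; done); (norm_num [HullCell]; done)])
         | (refine ⟨3, ?_, ?_, ?_⟩ <;>
             [(intro a ha; interval_cases a <;> (norm_num; done)); (norm_num; done); (norm_num [HullCell]; done)])
         | (refine ⟨4, ?_, ?_, ?_⟩ <;>
             [(intro a ha; interval_cases a <;> (norm_num; done)); (norm_num; done); (norm_num [HullCell]; done)]))

/-! ## §3. The rows: S_H FAILS at every datum over `(λ_k, l)`, `k ∈ {8, 9, 10, 11}`, primes `11 ≤ l ≤ 71`, `l ∤ k` -/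

/-- **GENUINE-NEG, `k ∈ {8, 10}`, EVERY prime `11 ≤ l ≤ 71`**: at EVERY genuine Θ-volume datum `T` over `(ratPoint λ_k, l)`, for EVERY choice
of the free context binders and Kummer data, `Cor312Vol.PilotKummerCompatHull` at the sharp genuine setting with the CHOSEN realising ideles and the
PINNED reading FAILS (the per-datum instance shape of `hSHw` of `Conditional.abc_of_SH_v10K_window`) — the engine p473071 at `B = 15`
(`GenuineK.localType_lamSeven_fifteen`), top label, cells `cells_even`. [cite: Mochizuki2012, IUTchIII Cor. 3.12 Step (xi-f) p. 184; IUTchIV Prop. 1.2 (i)(ii) p. 10]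
[claim: Mochizuki2012, status: disputed] -/
theorem HexHullThreshold.not_pilotKummerCompatHull_lamSeven_even {k l : ℕ} (hk : k ∈ ({8, 10} : Finset ℕ))
    (hl : l ∈ ({11, 13, 17, 19, 23, 29, 31, 37, 41, 43, 47, 53, 59, 61, 67, 71} : Finset ℕ))
    (T : Cor22.ThetaVolumeDatumAt (ratPoint ((2 : ℚ)⁻¹ + 2 / 7 ^ k)) l) :
    letI := T.instFieldF; letI := T.instNumberFieldF; letI := T.instAlgebraF; letI := T.instFieldK
    letI := T.instNumberFieldK; letI := T.instAlgebraK; letI := T.instFieldFbar; letI := T.instAlgebraFbar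
    letI := T.instAlgebraKFbar; letI := T.instIsElliptic
    ∀ (M : Type) [Field M] [NumberField M]
      (archPk : ∀ (j : (thetaIndex (pilotDataOfK T.D T.K)).Label) (vQ : (thetaIndex (pilotDataOfK T.D T.K)).VQ),
        Set ((logShellsDH (pilotDataOfK T.D T.K) (analyticLogv T.K)).Packet j vQ))
      (archSub : ∀ (j : (thetaIndex (pilotDataOfK T.D T.K)).Label) (v : (thetaIndex (pilotDataOfK T.D T.K)).V),
        Set ((logShellsDH (pilotDataOfK T.D T.K) (analyticLogv T.K)).Packet j ((thetaIndex (pilotDataOfK T.D T.K)).over v)))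
      (Ψ : ℤ → ∀ v : (thetaIndex (pilotDataOfK T.D T.K)).V, v ∈ (thetaIndex (pilotDataOfK T.D T.K)).Vbad →
        Set ((logShellsDH (pilotDataOfK T.D T.K) (analyticLogv T.K)).StarPacket v))
      (act : ℤ → ∀ v : (thetaIndex (pilotDataOfK T.D T.K)).V, v ∈ (thetaIndex (pilotDataOfK T.D T.K)).Vbad →
        (logShellsDH (pilotDataOfK T.D T.K) (analyticLogv T.K)).StarPacket v →
          Module.End ℚ ((logShellsDH (pilotDataOfK T.D T.K) (analyticLogv T.K)).StarPacket v))
      (Mmod : ℤ → ∀ j : (thetaIndex (pilotDataOfK T.D T.K)).LabelStar,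
        Set ((logShellsDH (pilotDataOfK T.D T.K) (analyticLogv T.K)).GlobalPacket j.1))
      (region : ℤ → ∀ j : (thetaIndex (pilotDataOfK T.D T.K)).LabelStar, FinDivisor M →
        ∀ vQ : (thetaIndex (pilotDataOfK T.D T.K)).VQ, Set ((logShellsDH (pilotDataOfK T.D T.K) (analyticLogv T.K)).Packet j.1 vQ))
      (frobAdm : ℤ → ℤ → ∀ (j : (thetaIndex (pilotDataOfK T.D T.K)).Label) (vQ : (thetaIndex (pilotDataOfK T.D T.K)).VQ),
        Set ((logShellsDH (pilotDataOfK T.D T.K) (analyticLogv T.K)).Packet j vQ) → Prop)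
      (frobLogvol : ℤ → ℤ → ∀ (j : (thetaIndex (pilotDataOfK T.D T.K)).Label) (vQ : (thetaIndex (pilotDataOfK T.D T.K)).VQ),
        Set ((logShellsDH (pilotDataOfK T.D T.K) (analyticLogv T.K)).Packet j vQ) → ℝ)
      (frobΨ : ℤ → ℤ → ∀ v : (thetaIndex (pilotDataOfK T.D T.K)).V, v ∈ (thetaIndex (pilotDataOfK T.D T.K)).Vbad →
        Set ((logShellsDH (pilotDataOfK T.D T.K) (analyticLogv T.K)).StarPacket v))
      (frobMmod : ℤ → ℤ → ∀ j : (thetaIndex (pilotDataOfK T.D T.K)).LabelStar,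
        Set ((logShellsDH (pilotDataOfK T.D T.K) (analyticLogv T.K)).GlobalPacket j.1))
      (unitImage : ℤ → ℤ → ℕ → ∀ (j : (thetaIndex (pilotDataOfK T.D T.K)).Label) (vQ : (thetaIndex (pilotDataOfK T.D T.K)).VQ),
        Set ((logShellsDH (pilotDataOfK T.D T.K) (analyticLogv T.K)).Packet j vQ))
      (ballImage : ℤ → ℤ → ∀ (j : (thetaIndex (pilotDataOfK T.D T.K)).Label) (vQ : (thetaIndex (pilotDataOfK T.D T.K)).VQ),
        Set ((logShellsDH (pilotDataOfK T.D T.K) (analyticLogv T.K)).Packet j vQ))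
      (thetaDiv : ℤ → ℤ → LgpDivisor M (thetaIndex (pilotDataOfK T.D T.K)).lstar)
      (n : ℤ) {HT : Type} {LogLink : HT → HT → Type} {IsFull : ∀ {s t : HT}, LogLink s t → Prop}
      (lat : LGPGaussianLogThetaLattice LogLink IsFull)
      {Frd : Type} {IsoF : Frd → Frd → Type} {Ob : Frd → Type} {realify : Frd → Frd} {Strip : Type}
      {IsoS : Strip → Strip → Type} {Mv : ∀ v : (thetaIndex (pilotDataOfK T.D T.K)).V, v ∈ (thetaIndex (pilotDataOfK T.D T.K)).Vbad → Type}
      [∀ v h, Monoid (Mv v h)]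
      (sig : GlobalLGPFrobenioidSignature (thetaIndex (pilotDataOfK T.D T.K)).lstar (thetaIndex (pilotDataOfK T.D T.K)).V
        (· ∈ (thetaIndex (pilotDataOfK T.D T.K)).Vbad) Frd IsoF Ob realify Strip IsoS Mv)
      (split : SplittingMonoids Mv) {ObΔ : Type}
      {N : ∀ v : (thetaIndex (pilotDataOfK T.D T.K)).V, v ∈ (thetaIndex (pilotDataOfK T.D T.K)).Vbad → Type}
      [∀ v h, Monoid (N v h)] (qData : QPilotData ObΔ N)
      (qK : ∀ v : (thetaIndex (pilotDataOfK T.D T.K)).V, v ∈ (thetaIndex (pilotDataOfK T.D T.K)).Vbad →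
        Set ((logShellsDH (pilotDataOfK T.D T.K) (analyticLogv T.K)).StarPacket v)),
    ¬ Cor312Vol.PilotKummerCompatHull
        (LatticeSituation.ofShells (logShellsDH (pilotDataOfK T.D T.K) (analyticLogv T.K)) M archPk archSub
          (summandPiecesPr (pilotDataOfK T.D T.K) (logvAnalytic_analyticLogv (F := T.K))).Adm
          (summandPiecesPr (pilotDataOfK T.D T.K) (logvAnalytic_analyticLogv (F := T.K))).logvol Ψ act Mmod region frobAdm
          frobLogvol frobΨ frobMmod unitImage ballImage thetaDiv)
        (settingPrVolSharp (pilotDataOfK T.D T.K) (logvAnalytic_analyticLogv (F := T.K)) M archPk archSub Ψ act Mmod region n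
          lat sig split qData (exists_realising_qIdeles_pilotDataOfK T.D).choose (exists_realising_thetaIdeles_pilotDataOfK T.D).choose
          (exists_realising_qIdeles_pilotDataOfK T.D).choose_spec.1 (exists_realising_qIdeles_pilotDataOfK T.D).choose_spec.2.1)
        (fun _ => Cor312.Setting.qRegion
          (settingPrVolSharp (pilotDataOfK T.D T.K) (logvAnalytic_analyticLogv (F := T.K)) M archPk archSub Ψ act Mmod region n
            lat sig split qData (exists_realising_qIdeles_pilotDataOfK T.D).choose (exists_realising_thetaIdeles_pilotDataOfK T.D).choose
            (exists_realising_qIdeles_pilotDataOfK T.D).choose_spec.1 (exists_realising_qIdeles_pilotDataOfK T.D).choose_spec.2.1))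
        qK := by
  have hk' := hk; have hl' := hl
  simp only [Finset.mem_insert, Finset.mem_singleton] at hk' hl'
  have hk1 : 1 ≤ k := by rcases hk' with rfl | rfl <;> norm_num
  have hke : Even k := by rcases hk' with rfl | rfl <;> decide
  have h11 : 11 ≤ l := by rcases hl' with rfl | rfl | rfl | rfl | rfl | rfl | rfl | rfl | rfl | rfl | rfl | rfl | rfl | rfl | rfl | rfl <;> norm_num
  have hlp : l.Prime := by rcases hl' with rfl | rfl | rfl | rfl | rfl | rfl | rfl | rfl | rfl | rfl | rfl | rfl | rfl | rfl | rfl | rfl <;> norm_num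
  have hlk : ¬ l ∣ k := fun h => absurd (Nat.le_of_dvd (by omega) h) (by rcases hk' with rfl | rfl <;> omega)
  exact GenuineK.not_pilotKummerCompatHull_lamSeven_of_not_hullCell (B := 15) (i := (l - 1) / 2 - 1) hk1 hlp h11 hlk (by omega) T
    (fun x₀ => (GenuineK.localType_lamSeven_fifteen hk1 hke h11 T x₀).2) (HexHullThreshold.cells_even k hk l hl)

/-- **GENUINE-NEG, `k ∈ {9, 11}`, EVERY prime `11 ≤ l ≤ 71` with `l ∤ k`** (i.e. all but `(11, 11)`): the same conclusion — the engine p473071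
at `B = 30` (`GenuineK.localType_lamSeven_thirty`), top label, cells `cells_odd`. Includes the row `(11, 13)` that no ramification bound `≥ 30·l`
decides with the [LIN] engine (`HexDepthLocalTypeThirty`, module docstring). [cite: Mochizuki2012, IUTchIII Cor. 3.12 Step (xi-f) p. 184; IUTchIV Prop. 1.2 (i)(ii) p. 10]
[claim: Mochizuki2012, status: disputed] -/
theorem HexHullThreshold.not_pilotKummerCompatHull_lamSeven_odd {k l : ℕ} (hk : k ∈ ({9, 11} : Finset ℕ))
    (hl : l ∈ ({11, 13, 17, 19, 23, 29, 31, 37, 41, 43, 47, 53, 59, 61, 67, 71} : Finset ℕ)) (hlk : ¬ l ∣ k)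
    (T : Cor22.ThetaVolumeDatumAt (ratPoint ((2 : ℚ)⁻¹ + 2 / 7 ^ k)) l) :
    letI := T.instFieldF; letI := T.instNumberFieldF; letI := T.instAlgebraF; letI := T.instFieldK
    letI := T.instNumberFieldK; letI := T.instAlgebraK; letI := T.instFieldFbar; letI := T.instAlgebraFbar
    letI := T.instAlgebraKFbar; letI := T.instIsElliptic
    ∀ (M : Type) [Field M] [NumberField M]
      (archPk : ∀ (j : (thetaIndex (pilotDataOfK T.D T.K)).Label) (vQ : (thetaIndex (pilotDataOfK T.D T.K)).VQ),
        Set ((logShellsDH (pilotDataOfK T.D T.K) (analyticLogv T.K)).Packet j vQ))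
      (archSub : ∀ (j : (thetaIndex (pilotDataOfK T.D T.K)).Label) (v : (thetaIndex (pilotDataOfK T.D T.K)).V),
        Set ((logShellsDH (pilotDataOfK T.D T.K) (analyticLogv T.K)).Packet j ((thetaIndex (pilotDataOfK T.D T.K)).over v)))
      (Ψ : ℤ → ∀ v : (thetaIndex (pilotDataOfK T.D T.K)).V, v ∈ (thetaIndex (pilotDataOfK T.D T.K)).Vbad →
        Set ((logShellsDH (pilotDataOfK T.D T.K) (analyticLogv T.K)).StarPacket v))
      (act : ℤ → ∀ v : (thetaIndex (pilotDataOfK T.D T.K)).V, v ∈ (thetaIndex (pilotDataOfK T.D T.K)).Vbad →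
        (logShellsDH (pilotDataOfK T.D T.K) (analyticLogv T.K)).StarPacket v →
          Module.End ℚ ((logShellsDH (pilotDataOfK T.D T.K) (analyticLogv T.K)).StarPacket v))
      (Mmod : ℤ → ∀ j : (thetaIndex (pilotDataOfK T.D T.K)).LabelStar,
        Set ((logShellsDH (pilotDataOfK T.D T.K) (analyticLogv T.K)).GlobalPacket j.1))
      (region : ℤ → ∀ j : (thetaIndex (pilotDataOfK T.D T.K)).LabelStar, FinDivisor M →
        ∀ vQ : (thetaIndex (pilotDataOfK T.D T.K)).VQ, Set ((logShellsDH (pilotDataOfK T.D T.K) (analyticLogv T.K)).Packet j.1 vQ))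
      (frobAdm : ℤ → ℤ → ∀ (j : (thetaIndex (pilotDataOfK T.D T.K)).Label) (vQ : (thetaIndex (pilotDataOfK T.D T.K)).VQ),
        Set ((logShellsDH (pilotDataOfK T.D T.K) (analyticLogv T.K)).Packet j vQ) → Prop)
      (frobLogvol : ℤ → ℤ → ∀ (j : (thetaIndex (pilotDataOfK T.D T.K)).Label) (vQ : (thetaIndex (pilotDataOfK T.D T.K)).VQ),
        Set ((logShellsDH (pilotDataOfK T.D T.K) (analyticLogv T.K)).Packet j vQ) → ℝ)
      (frobΨ : ℤ → ℤ → ∀ v : (thetaIndex (pilotDataOfK T.D T.K)).V, v ∈ (thetaIndex (pilotDataOfK T.D T.K)).Vbad →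
        Set ((logShellsDH (pilotDataOfK T.D T.K) (analyticLogv T.K)).StarPacket v))
      (frobMmod : ℤ → ℤ → ∀ j : (thetaIndex (pilotDataOfK T.D T.K)).LabelStar,
        Set ((logShellsDH (pilotDataOfK T.D T.K) (analyticLogv T.K)).GlobalPacket j.1))
      (unitImage : ℤ → ℤ → ℕ → ∀ (j : (thetaIndex (pilotDataOfK T.D T.K)).Label) (vQ : (thetaIndex (pilotDataOfK T.D T.K)).VQ),
        Set ((logShellsDH (pilotDataOfK T.D T.K) (analyticLogv T.K)).Packet j vQ))
      (ballImage : ℤ → ℤ → ∀ (j : (thetaIndex (pilotDataOfK T.D T.K)).Label) (vQ : (thetaIndex (pilotDataOfK T.D T.K)).VQ),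
        Set ((logShellsDH (pilotDataOfK T.D T.K) (analyticLogv T.K)).Packet j vQ))
      (thetaDiv : ℤ → ℤ → LgpDivisor M (thetaIndex (pilotDataOfK T.D T.K)).lstar)
      (n : ℤ) {HT : Type} {LogLink : HT → HT → Type} {IsFull : ∀ {s t : HT}, LogLink s t → Prop}
      (lat : LGPGaussianLogThetaLattice LogLink IsFull)
      {Frd : Type} {IsoF : Frd → Frd → Type} {Ob : Frd → Type} {realify : Frd → Frd} {Strip : Type}
      {IsoS : Strip → Strip → Type} {Mv : ∀ v : (thetaIndex (pilotDataOfK T.D T.K)).V, v ∈ (thetaIndex (pilotDataOfK T.D T.K)).Vbad → Type}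
      [∀ v h, Monoid (Mv v h)]
      (sig : GlobalLGPFrobenioidSignature (thetaIndex (pilotDataOfK T.D T.K)).lstar (thetaIndex (pilotDataOfK T.D T.K)).V
        (· ∈ (thetaIndex (pilotDataOfK T.D T.K)).Vbad) Frd IsoF Ob realify Strip IsoS Mv)
      (split : SplittingMonoids Mv) {ObΔ : Type}
      {N : ∀ v : (thetaIndex (pilotDataOfK T.D T.K)).V, v ∈ (thetaIndex (pilotDataOfK T.D T.K)).Vbad → Type}
      [∀ v h, Monoid (N v h)] (qData : QPilotData ObΔ N)
      (qK : ∀ v : (thetaIndex (pilotDataOfK T.D T.K)).V, v ∈ (thetaIndex (pilotDataOfK T.D T.K)).Vbad →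
        Set ((logShellsDH (pilotDataOfK T.D T.K) (analyticLogv T.K)).StarPacket v)),
    ¬ Cor312Vol.PilotKummerCompatHull
        (LatticeSituation.ofShells (logShellsDH (pilotDataOfK T.D T.K) (analyticLogv T.K)) M archPk archSub
          (summandPiecesPr (pilotDataOfK T.D T.K) (logvAnalytic_analyticLogv (F := T.K))).Adm
          (summandPiecesPr (pilotDataOfK T.D T.K) (logvAnalytic_analyticLogv (F := T.K))).logvol Ψ act Mmod region frobAdm
          frobLogvol frobΨ frobMmod unitImage ballImage thetaDiv)
        (settingPrVolSharp (pilotDataOfK T.D T.K) (logvAnalytic_analyticLogv (F := T.K)) M archPk archSub Ψ act Mmod region n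
          lat sig split qData (exists_realising_qIdeles_pilotDataOfK T.D).choose (exists_realising_thetaIdeles_pilotDataOfK T.D).choose
          (exists_realising_qIdeles_pilotDataOfK T.D).choose_spec.1 (exists_realising_qIdeles_pilotDataOfK T.D).choose_spec.2.1)
        (fun _ => Cor312.Setting.qRegion
          (settingPrVolSharp (pilotDataOfK T.D T.K) (logvAnalytic_analyticLogv (F := T.K)) M archPk archSub Ψ act Mmod region n
            lat sig split qData (exists_realising_qIdeles_pilotDataOfK T.D).choose (exists_realising_thetaIdeles_pilotDataOfK T.D).choose
            (exists_realising_qIdeles_pilotDataOfK T.D).choose_spec.1 (exists_realising_qIdeles_pilotDataOfK T.D).choose_spec.2.1))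
        qK := by
  have hk' := hk; have hl' := hl
  simp only [Finset.mem_insert, Finset.mem_singleton] at hk' hl'
  have hk1 : 1 ≤ k := by rcases hk' with rfl | rfl <;> norm_num
  have h11 : 11 ≤ l := by rcases hl' with rfl | rfl | rfl | rfl | rfl | rfl | rfl | rfl | rfl | rfl | rfl | rfl | rfl | rfl | rfl | rfl <;> norm_num
  have hlp : l.Prime := by rcases hl' with rfl | rfl | rfl | rfl | rfl | rfl | rfl | rfl | rfl | rfl | rfl | rfl | rfl | rfl | rfl | rfl <;> norm_num
  exact GenuineK.not_pilotKummerCompatHull_lamSeven_of_not_hullCell (B := 30) (i := (l - 1) / 2 - 1) hk1 hlp h11 hlk (by omega) T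
    (fun x₀ => (GenuineK.localType_lamSeven_thirty hk1 h11 T x₀).2) (HexHullThreshold.cells_odd k hk l hl hlk)

end Summit.ABC.IUTFork.Conditional

end
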